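import Mathlib

/-!
# `BalabanImbrieJaffe1984to88.BIJ88SupportLaws274` — T. Bałaban, J. Imbrie, A. Jaffe, *Effective action and cluster properties of the
abelian Higgs model*, Commun. Math. Phys. **114** (1988) 257–315 [BalabanImbrieJaffe1988], Sect. 4 p. 274 with (2.6), (2.8), (2.14), (5.5.5):
the SUPPORT LAWS behind the manipulations of §§5.3–5.8 — characteristic functions of the nested regions `Λ_α^{(k)}` dropped against
kernels of finite range — PROVED as a finite-range ∕ collar calculus of matrices, discharging (in matrix form) the support hypotheses
carried by `BIJ88Quad535.eq535`, `BIJ88CrossTerm556.Ops.Laws`, `BIJ88GaugeSummary5512.Ops.Laws`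

statement-level skeleton of published theorems with citation tags; proofs where landed; nothing here is a claim about the Yang–Mills mass gap

PDF held: `paper:balaban1988-cmp114-bij-abelian-higgs-effective-action` (journal page = PDF page + 256).  Renders read this session as images:
p. 274 = PDF 18 (`lit-balaban-r16/renders/cmp114/original-p018-x2.png`), p. 261 = PDF 5 (`…-p005-x2.png`), p. 284 = PDF 28.

**What the paper prints.**  p. 274 (Sect. 4), verbatim: *"For j ≥ 1, α = 1, …, 8, 11 the sets Λ_α^{(j)} are determined by Λ_{α−1}^{(j)} by
subtracting collar neighborhoods of width r(e_j) in the L^jη-lattice. We have Λ_α^{(j)} ⊂ Λ_{α−1}^{(j)}."*  The localized kernels have ranges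
small against `r(e_k)`: (2.6) *"H_{k,loc}(b, b′) = 0 for dist(b, b′) ≥ ⅛r(e_k)"*, (2.8) `C̃^{(k)}(b₁, b₂) = 0` unless `dist(b₁, b₂) ≤ ¼r(e_k)`, (2.14)
`σ_{k,loc}(p₁, p₂) = 0` unless `dist(p₁, p₂) ≤ (1/2L)r(e_{k−1})`, (5.5.5) p. 284 *"The kernels w′₃, w″₃ have range less than ½r(e_k)"*.  On
pp. 280–296 the print then drops characteristic functions silently — e.g. between (5.5.3) and (5.5.8) `Λ₁^{(k)**}∂Λ₄^{(k)*} = ∂Λ₄^{(k)*}`,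
`Λ₁^{(k)**}Q^e_k∂^ηH_{k,loc}Λ₂^{(k)*} = Q^e_k∂^ηH_{k,loc}Λ₂^{(k)*}`, in (5.3.5) *"σ_{k,loc} does not couple Λ₂^{(k)**} to Λ₁^{(k)**c}"* (the reason the
cross term carries `Λ₂^{(k)c**}`) — which the tree's files `BIJ88Quad535` (hypothesis `hrange`), `BIJ88CrossTerm556.Ops.Laws` (`hΛ14`, `hΛ12`,
`hΛ1J`, `hΛ4σ`, `hΛ45`, `hΛ25`) and `BIJ88GaugeSummary5512.Ops.Laws` (`hΛ24`, `hΛ1Q5`, `hΛ5p1`, `hΛ15p`, `hΛ12ss`, `hrange535`) take as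
HYPOTHESES.

**What is reproduced here (kernel-checked, zero `sorry`, no named facts; Mathlib only).**  A finite index type `ι` of lattice objects with an
abstract "distance" `ρ : ι → ι → ℝ` (only the triangle inequality ∕ symmetry are assumed, where used); operators = real matrices
`Matrix ι ι ℝ`; regions = `Finset ι`.
* DEFINITIONS: `ind`/`chi S` (the characteristic function of `S` as a multiplication operator), **`HasRange ρ K r`** (`K(i,j) ≠ 0 ⇒ ρ(i,j) ≤ r`
  — the shape of (2.6)/(2.8)/(2.14)/(5.5.5)), **`Collar ρ r T S`** (the `r`-neighbourhood of `T` lies in `S`), **`shrink ρ w S`** (p. 274's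
  construction: `S` minus a collar of width `w`).
* χ-algebra: `chi_mul_chi` (`χ_Sχ_T = χ_{S∩T}`), `chi_mul_chi_of_subset`/`'` (nested regions: `χ_Sχ_T = χ_T = χ_Tχ_S` — the shape of `hΛ24`,
  `hΛ5p1`, `hΛ15p`, `hΛ12ss`), `chi_idem`, `chi_transpose`, `one_sub_chi` (`1 − χ_S = χ_{Sᶜ}`), `chi_univ`.
* **THE DROP LAWS**: `chi_mul_mul_chi_eq` (`χ_S K χ_T = K χ_T` for `range K ≤ r` and the `r`-collar of `T` inside `S` — the shape of `hΛ14`,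
  `hΛ12`, `hΛ1J`, `hΛ45`, `hΛ25`, `hΛ1Q5`), `chi_mul_mul_chi_eq'` (mirror: `χ_T K χ_S = χ_T K`, the shape of `hΛ4σ`), `chi_mul_mul_one_sub_chi`
  (`χ_A K (1 − χ_B) = 0`: *"K does not couple A to Bᶜ"*, the shape of (5.3.5)'s range statement `hrange`/`hrange535`).
* range calculus: `HasRange.mono/add/neg/sub/smul/chi_mul/mul_chi/transpose`, `hasRange_zero/diagonal/chi/one`, **`HasRange.mul`** (ranges ADD
  under composition, by the triangle inequality — so `Q^e_k∂^ηH_{k,loc}`, `C_{loc}H*_{loc}∂*Q^{e*}_{k+1}`, `∂*σ_{k,loc}` have finite range), the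
  three-factor drop law `chi_mul_mul₃_mul_chi_eq` and the mirrored-then-composed law `chi_mul_mul_chi_mul_eq` (`hΛ4σ`).
* p. 274: `shrink_subset` (`Λ_α ⊂ Λ_{α−1}`), **`collar_shrink`** (the shrunk region has its `w`-collar inside the old one), `collar_of_subset_shrink`,
  `Collar.mono`, `Collar.symm`.
* transfer to the operator carriers of the §5 files: `map_dropLaw`/`map_zeroLaw` (any ring hom `Matrix ι ι ℝ →+* R`, e.g. into `Module.End ℝ M`),
  **`inner_eq_zero_of_opLaw`** (in any real inner-product space: `Λ` symmetric and `Λσ(1 − Λ′) = 0` ⇒ `⟨Λx, σ(y − Λ′y)⟩ = 0`, the literal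
  form of `BIJ88GaugeSummary5512.Ops.Laws.hrange535`).
* (v1.1) §8 THE EUCLIDEAN MODEL: `rep : Matrix ι ι ℝ →+* Module.End ℝ (EuclideanSpace ℝ ι)` (Mathlib's `Matrix.toEuclideanCLM`, continuity
  forgotten), `inner_rep`, `rep_symm` (symmetric kernels act symmetrically), **`rep_dropLaw`**, **`rep_inner_law`** — the drop law and the
  (5.3.5) range law AS OPERATOR STATEMENTS on a real inner-product space of lattice fields, i.e. in the exact form of the §5 files' laws.

**Readings (declared).**  (i) one index type for bonds ∕ plaquettes ∕ sites and one abstract distance (the print's `dist` on each lattice);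
(ii) "range" = support of the kernel in `ρ`, "collar of width w" = `shrink` (all points whose `w`-neighbourhood stays inside); (iii) the laws
are proved for matrices; the §5 files state them in `Module.End ℝ M`, reached by any representation (`map_dropLaw`).
**What is NOT claimed.**  The specific radii of the thirteen regions `Λ₀ ⊃ … ⊃ Λ₁₃` and of the cut-offs (only the mechanism *range ≤ collar*),
the smooth cut-offs `ζ_k, θ_k`, any bound ((2.7), (2.13), (5.5.5) sizes); nothing of B1–B16; NOT summit progress; NOT continuum; NOT Clay.
Imports Mathlib only; no Summits import; sub-namespace `…BIJ88SupportLaws274`; modifies nothing.  Cell `lit-balaban` Phase 2 (HOME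
`run/shared/lean/pub/lit-balaban/`), seat p02 gen 5 (`literature-prover-lit-balaban-p02-g5-0`); rows C2.Eq5.3.1-5.3.7, C2.Eq5.5.1-5.5.12,
C2.Eq5.8.1-5.8.3 (owner r16; p. 274 = C2.Txt@274, owner r18): support hypotheses → discharged in matrix form.
-/

namespace Literature.MathematicalPhysics.QuantumFieldTheory.BalabanImbrieJaffe1984to88.BIJ88SupportLaws274

open scoped RealInnerProductSpace

variable {ι : Type*}

/-! ## §1  Characteristic functions, finite range, collars -/

/-- the indicator weight of a region `S`: `1` on `S`, `0` off `S`. [cite: BalabanImbrieJaffe1988, Sect. 4 p.274] -/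
def ind [DecidableEq ι] (S : Finset ι) (i : ι) : ℝ := if i ∈ S then 1 else 0

/-- the characteristic function `χ_S` of a region as a multiplication operator (diagonal matrix) — the print's prefixes `Λ₁^{(k)**}`,
`Λ₂^{(k)*}`, `Λ₄^{(k)*}`, `Λ₅^{(k)′**}`, …. [cite: BalabanImbrieJaffe1988, Sect. 4 p.274] -/
def chi [DecidableEq ι] (S : Finset ι) : Matrix ι ι ℝ := Matrix.diagonal (ind S)

/-- FINITE RANGE: `K(i, j) ≠ 0 ⇒ ρ(i, j) ≤ r` — the shape of (2.6) *"H_{k,loc}(b,b′) = 0 for dist(b,b′) ≥ ⅛r(e_k)"*, (2.8), (2.14), (5.5.5).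
[cite: BalabanImbrieJaffe1988, (2.14) p.261] -/
def HasRange (ρ : ι → ι → ℝ) (K : Matrix ι ι ℝ) (r : ℝ) : Prop := ∀ i j, K i j ≠ 0 → ρ i j ≤ r

/-- COLLAR: the `r`-neighbourhood of `T` lies in `S` (`j ∈ T`, `ρ(i, j) ≤ r ⇒ i ∈ S`) — p. 274: *"Λ_α^{(j)} are determined by Λ_{α−1}^{(j)} by
subtracting collar neighborhoods of width r(e_j)"*. [cite: BalabanImbrieJaffe1988, Sect. 4 p.274] -/
def Collar (ρ : ι → ι → ℝ) (r : ℝ) (T S : Finset ι) : Prop := ∀ i j, j ∈ T → ρ i j ≤ r → i ∈ S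

/-! ## §2  The algebra of characteristic functions -/

/-- `ind S i = 1` on `S`. [cite: BalabanImbrieJaffe1988, Sect. 4 p.274] -/
@[simp] theorem ind_of_mem [DecidableEq ι] {S : Finset ι} {i : ι} (h : i ∈ S) : ind S i = 1 := if_pos h

/-- `ind S i = 0` off `S`. [cite: BalabanImbrieJaffe1988, Sect. 4 p.274] -/
@[simp] theorem ind_of_not_mem [DecidableEq ι] {S : Finset ι} {i : ι} (h : i ∉ S) : ind S i = 0 := if_neg h

/-- `ind S · ind T = ind (S ∩ T)`. [cite: BalabanImbrieJaffe1988, Sect. 4 p.274] -/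
theorem ind_mul_ind [DecidableEq ι] (S T : Finset ι) (i : ι) : ind S i * ind T i = ind (S ∩ T) i := by
  by_cases hS : i ∈ S <;> by_cases hT : i ∈ T <;> simp [ind, hS, hT, Finset.mem_inter]

/-- entries of `χ_S K`: `(χ_S K)(i, j) = ind_S(i) K(i, j)`. [cite: BalabanImbrieJaffe1988, Sect. 4 p.274] -/
theorem chi_mul_apply [Fintype ι] [DecidableEq ι] (S : Finset ι) (K : Matrix ι ι ℝ) (i j : ι) : (chi S * K) i j = ind S i * K i j :=
  Matrix.diagonal_mul _ _ _ _

/-- entries of `K χ_S`: `(K χ_S)(i, j) = K(i, j) ind_S(j)`. [cite: BalabanImbrieJaffe1988, Sect. 4 p.274] -/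
theorem mul_chi_apply [Fintype ι] [DecidableEq ι] (K : Matrix ι ι ℝ) (S : Finset ι) (i j : ι) : (K * chi S) i j = K i j * ind S j :=
  Matrix.mul_diagonal _ _ _ _

/-- `χ_S χ_T = χ_{S ∩ T}`. [cite: BalabanImbrieJaffe1988, Sect. 4 p.274] -/
theorem chi_mul_chi [Fintype ι] [DecidableEq ι] (S T : Finset ι) : chi S * chi T = chi (S ∩ T) := by
  rw [chi, chi, chi, Matrix.diagonal_mul_diagonal]
  congr 1
  funext i
  exact ind_mul_ind S T i

/-- nested regions, `T ⊂ S`: `χ_S χ_T = χ_T` (the shape of `Λ₂*Λ₄* = Λ₄*`, `Λ₅^{(k−1)′**}Λ₁** = Λ₁**`, `Λ₁**Λ₂** = Λ₂**`).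
[cite: BalabanImbrieJaffe1988, Sect. 4 p.274] -/
theorem chi_mul_chi_of_subset [Fintype ι] [DecidableEq ι] {S T : Finset ι} (h : T ⊆ S) : chi S * chi T = chi T := by
  rw [chi_mul_chi, Finset.inter_eq_right.mpr h]

/-- nested regions, `T ⊂ S`: `χ_T χ_S = χ_T` (the shape of `Λ₁**Λ₅^{(k−1)′**} = Λ₁**`). [cite: BalabanImbrieJaffe1988, Sect. 4 p.274] -/
theorem chi_mul_chi_of_subset' [Fintype ι] [DecidableEq ι] {S T : Finset ι} (h : T ⊆ S) : chi T * chi S = chi T := by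
  rw [chi_mul_chi, Finset.inter_eq_left.mpr h]

/-- `χ_S` is idempotent. [cite: BalabanImbrieJaffe1988, Sect. 4 p.274] -/
theorem chi_idem [Fintype ι] [DecidableEq ι] (S : Finset ι) : chi S * chi S = chi S := chi_mul_chi_of_subset subset_rfl

/-- `χ_S` is symmetric. [cite: BalabanImbrieJaffe1988, Sect. 4 p.274] -/
theorem chi_transpose [DecidableEq ι] (S : Finset ι) : (chi S).transpose = chi S := Matrix.diagonal_transpose _

/-- `χ` of everything is the identity. [cite: BalabanImbrieJaffe1988, Sect. 4 p.274] -/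
theorem chi_univ [Fintype ι] [DecidableEq ι] : chi (Finset.univ : Finset ι) = 1 := by
  ext i j
  by_cases hij : i = j
  · subst hij; simp [chi, ind]
  · simp [chi, hij]

/-- complements: `1 − χ_S = χ_{Sᶜ}` (the print's `Λ^{c}`-prefixes, e.g. `Λ₂^{(k)*c}A = A − Λ₂^{(k)*}A`). [cite: BalabanImbrieJaffe1988, (5.5.6) p.284] -/
theorem one_sub_chi [Fintype ι] [DecidableEq ι] (S : Finset ι) : 1 - chi S = chi Sᶜ := by
  ext i j
  simp only [chi, Matrix.sub_apply, Matrix.one_apply, Matrix.diagonal_apply, ind, Finset.mem_compl]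
  by_cases hij : i = j
  · subst hij
    by_cases hS : i ∈ S <;> simp [hS]
  · simp [hij]

/-! ## §3  The drop laws -/

/-- **DROP LAW (outer characteristic function).**  If `K` has range `≤ r` and the `r`-collar of `T` lies inside `S`, then `χ_S K χ_T = K χ_T`
— the shape of `Λ₁^{(k)**}∂Λ₄^{(k)*} = ∂Λ₄^{(k)*}`, `Λ₁**Q^e_k∂^ηH_{k,loc}Λ₂* = Q^e_k∂^ηH_{k,loc}Λ₂*`, `Λ₄*C_{loc}H*_{loc}∂*Q^{e*}_{k+1}Λ₅′** = C_{loc}H*_{loc}∂*Q^{e*}_{k+1}Λ₅′**`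
used silently between (5.5.3) and (5.5.8). [cite: BalabanImbrieJaffe1988, (5.5.6) p.284] -/
theorem chi_mul_mul_chi_eq [Fintype ι] [DecidableEq ι] {ρ : ι → ι → ℝ} {K : Matrix ι ι ℝ} {r : ℝ} {S T : Finset ι} (hK : HasRange ρ K r)
    (hc : Collar ρ r T S) : chi S * K * chi T = K * chi T := by
  ext i j
  rw [Matrix.mul_assoc, chi_mul_apply, mul_chi_apply]
  by_cases hT : j ∈ T
  · by_cases hk : K i j = 0
    · simp [hk]
    · rw [ind_of_mem (hc i j hT (hK i j hk)), one_mul]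
  · simp [ind_of_not_mem hT]

/-- **DROP LAW (mirror).**  If `K` has range `≤ r` and every point within `r` of `T` lies in `S`, then `χ_T K χ_S = χ_T K` — the shape of
`Λ₄*∂*σ_{k,loc}Λ₁**∂ = Λ₄*∂*σ_{k,loc}∂`. [cite: BalabanImbrieJaffe1988, (5.5.6) p.284] -/
theorem chi_mul_mul_chi_eq' [Fintype ι] [DecidableEq ι] {ρ : ι → ι → ℝ} {K : Matrix ι ι ℝ} {r : ℝ} {S T : Finset ι} (hK : HasRange ρ K r)
    (hc : ∀ i j, i ∈ T → ρ i j ≤ r → j ∈ S) : chi T * K * chi S = chi T * K := by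
  ext i j
  rw [mul_chi_apply, chi_mul_apply]
  by_cases hT : i ∈ T
  · by_cases hk : K i j = 0
    · simp [hk]
    · rw [ind_of_mem (hc i j hT (hK i j hk)), mul_one]
  · simp [ind_of_not_mem hT]

/-- **NO COUPLING ACROSS A COLLAR.**  If `K` has range `≤ r` and every point within `r` of `A` lies in `B`, then `χ_A K (1 − χ_B) = 0` — the
range statement of (5.3.5): *σ_{k,loc} does not couple `Λ₂^{(k)**}` to `Λ₁^{(k)**c}`* (hypothesis `hrange` of `BIJ88Quad535.eq535`, law
`hrange535` of `BIJ88GaugeSummary5512`). [cite: BalabanImbrieJaffe1988, (5.3.5) p.280] -/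
theorem chi_mul_mul_one_sub_chi [Fintype ι] [DecidableEq ι] {ρ : ι → ι → ℝ} {K : Matrix ι ι ℝ} {r : ℝ} {A B : Finset ι} (hK : HasRange ρ K r)
    (hc : ∀ i j, i ∈ A → ρ i j ≤ r → j ∈ B) : chi A * K * (1 - chi B) = 0 := by
  rw [mul_sub, mul_one, chi_mul_mul_chi_eq' hK hc, sub_self]

/-- entrywise form of the no-coupling law: `K(i, j) = 0` for `i ∈ A`, `j ∉ B` (the hypothesis `hrange` of `BIJ88Quad535.eq535` verbatim).
[cite: BalabanImbrieJaffe1988, (5.3.5) p.280] -/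
theorem apply_eq_zero_of_range {ρ : ι → ι → ℝ} {K : Matrix ι ι ℝ} {r : ℝ} {A B : Finset ι} (hK : HasRange ρ K r)
    (hc : ∀ i j, i ∈ A → ρ i j ≤ r → j ∈ B) {i j : ι} (hi : i ∈ A) (hj : j ∉ B) : K i j = 0 := by
  by_contra hk
  exact hj (hc i j hi (hK i j hk))

/-! ## §4  Range calculus -/

section Range

variable {ρ : ι → ι → ℝ} {K K' : Matrix ι ι ℝ} {r r' : ℝ}

/-- ranges may be enlarged. [cite: BalabanImbrieJaffe1988, (2.14) p.261] -/
theorem HasRange.mono (h : HasRange ρ K r) (hr : r ≤ r') : HasRange ρ K r' := fun i j hij => (h i j hij).trans hr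

/-- the zero kernel has every range. [cite: BalabanImbrieJaffe1988, (2.14) p.261] -/
theorem hasRange_zero (ρ : ι → ι → ℝ) (r : ℝ) : HasRange ρ (0 : Matrix ι ι ℝ) r := fun _ _ h => (h rfl).elim

/-- sums keep the range. [cite: BalabanImbrieJaffe1988, (2.14) p.261] -/
theorem HasRange.add (h : HasRange ρ K r) (h' : HasRange ρ K' r) : HasRange ρ (K + K') r := by
  intro i j hij
  by_cases hk : K i j = 0
  · have hk' : K' i j ≠ 0 := by
      intro h0
      apply hij
      rw [Matrix.add_apply, hk, h0, add_zero]
    exact h' i j hk'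
  · exact h i j hk

/-- negation keeps the range. [cite: BalabanImbrieJaffe1988, (2.14) p.261] -/
theorem HasRange.neg (h : HasRange ρ K r) : HasRange ρ (-K) r := fun i j hij => h i j (by
  intro h0
  apply hij
  rw [Matrix.neg_apply, h0, neg_zero])

/-- differences keep the range (`σ_{k,loc} − σ_k`-type remainders on the common support). [cite: BalabanImbrieJaffe1988, (2.14) p.261] -/
theorem HasRange.sub (h : HasRange ρ K r) (h' : HasRange ρ K' r) : HasRange ρ (K - K') r := by
  rw [sub_eq_add_neg]
  exact h.add h'.neg

/-- scalar multiples keep the range (the `L⁻²`'s). [cite: BalabanImbrieJaffe1988, (2.14) p.261] -/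
theorem HasRange.smul (c : ℝ) (h : HasRange ρ K r) : HasRange ρ (c • K) r := fun i j hij => h i j (by
  intro h0
  apply hij
  rw [Matrix.smul_apply, h0, smul_zero])

/-- restricting on the left keeps the range. [cite: BalabanImbrieJaffe1988, (2.14) p.261] -/
theorem HasRange.chi_mul [Fintype ι] [DecidableEq ι] (S : Finset ι) (h : HasRange ρ K r) : HasRange ρ (chi S * K) r := fun i j hij => h i j (by
  intro h0
  apply hij
  rw [chi_mul_apply, h0, mul_zero])

/-- restricting on the right keeps the range. [cite: BalabanImbrieJaffe1988, (2.14) p.261] -/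
theorem HasRange.mul_chi [Fintype ι] [DecidableEq ι] (S : Finset ι) (h : HasRange ρ K r) : HasRange ρ (K * chi S) r := fun i j hij => h i j (by
  intro h0
  apply hij
  rw [mul_chi_apply, h0, zero_mul])

/-- diagonal operators have range `0` (for a distance vanishing on the diagonal). [cite: BalabanImbrieJaffe1988, (2.14) p.261] -/
theorem hasRange_diagonal [DecidableEq ι] (hρ : ∀ i, ρ i i ≤ 0) (d : ι → ℝ) : HasRange ρ (Matrix.diagonal d) 0 := by
  intro i j hij
  by_cases h : i = j
  · subst h
    exact hρ i
  · exact (hij (Matrix.diagonal_apply_ne d h)).elim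

/-- characteristic functions have range `0`. [cite: BalabanImbrieJaffe1988, Sect. 4 p.274] -/
theorem hasRange_chi [DecidableEq ι] (hρ : ∀ i, ρ i i ≤ 0) (S : Finset ι) : HasRange ρ (chi S) 0 := hasRange_diagonal hρ _

/-- the identity has range `0`. [cite: BalabanImbrieJaffe1988, (2.14) p.261] -/
theorem hasRange_one [DecidableEq ι] (hρ : ∀ i, ρ i i ≤ 0) : HasRange ρ (1 : Matrix ι ι ℝ) 0 := by
  rw [← Matrix.diagonal_one]
  exact hasRange_diagonal hρ _

/-- **RANGES ADD UNDER COMPOSITION** (triangle inequality): `range(KK′) ≤ range K + range K′` — so the composite kernels of §5.5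
(`Q^e_k∂^ηH_{k,loc}`, `C^{(k)}_{loc}H*_{k,loc}∂*Q^{e*}_{k+1}`, `∂*σ_{k,loc}∂`, …) have ranges `O(r(e_k))` below the collar widths.
[cite: BalabanImbrieJaffe1988, (5.5.5) p.284] -/
theorem HasRange.mul [Fintype ι] (htri : ∀ i j l, ρ i l ≤ ρ i j + ρ j l) (h : HasRange ρ K r) (h' : HasRange ρ K' r') :
    HasRange ρ (K * K') (r + r') := by
  intro i l hil
  by_contra hgt
  apply hil
  rw [Matrix.mul_apply]
  refine Finset.sum_eq_zero fun j _ => ?_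
  by_cases hk : K i j = 0
  · rw [hk, zero_mul]
  by_cases hk' : K' j l = 0
  · rw [hk', mul_zero]
  exact (hgt ((htri i j l).trans (add_le_add (h i j hk) (h' j l hk')))).elim

/-- transposes (adjoint kernels `H*`, `∂*`, `Q^{e*}`) keep the range, for a symmetric distance. [cite: BalabanImbrieJaffe1988, (2.14) p.261] -/
theorem HasRange.transpose (hsym : ∀ i j, ρ i j = ρ j i) (h : HasRange ρ K r) : HasRange ρ K.transpose r :=
  fun i j hij => by
    rw [hsym]
    exact h j i hij

end Range

/-! ## §5  p. 274: regions by subtracting collars -/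

section Collars

variable {ρ : ι → ι → ℝ} {r r' w : ℝ} {S T : Finset ι}

/-- p. 274's construction: `S` minus a collar of width `w` = the points of `S` whose whole `w`-neighbourhood lies in `S`.
[cite: BalabanImbrieJaffe1988, Sect. 4 p.274] -/
noncomputable def shrink [Fintype ι] [DecidableEq ι] (ρ : ι → ι → ℝ) (w : ℝ) (S : Finset ι) : Finset ι :=
  S.filter fun j => ∀ i, ρ i j ≤ w → i ∈ S

/-- *"We have Λ_α^{(j)} ⊂ Λ_{α−1}^{(j)}"* (p. 274). [cite: BalabanImbrieJaffe1988, Sect. 4 p.274] -/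
theorem shrink_subset [Fintype ι] [DecidableEq ι] (ρ : ι → ι → ℝ) (w : ℝ) (S : Finset ι) : shrink ρ w S ⊆ S := Finset.filter_subset _ _

/-- membership in the shrunk region. [cite: BalabanImbrieJaffe1988, Sect. 4 p.274] -/
theorem mem_shrink [Fintype ι] [DecidableEq ι] {j : ι} : j ∈ shrink ρ w S ↔ j ∈ S ∧ ∀ i, ρ i j ≤ w → i ∈ S := Finset.mem_filter

/-- **the shrunk region has its `w`-collar inside the old region.** [cite: BalabanImbrieJaffe1988, Sect. 4 p.274] -/
theorem collar_shrink [Fintype ι] [DecidableEq ι] (ρ : ι → ι → ℝ) (w : ℝ) (S : Finset ι) : Collar ρ w (shrink ρ w S) S :=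
  fun i _ hj hij => (mem_shrink.mp hj).2 i hij

/-- any region inside the shrunk one inherits the collar (the later `Λ_α`, `α′ > α`). [cite: BalabanImbrieJaffe1988, Sect. 4 p.274] -/
theorem collar_of_subset_shrink [Fintype ι] [DecidableEq ι] (hT : T ⊆ shrink ρ w S) : Collar ρ w T S :=
  fun i j hj hij => collar_shrink ρ w S i j (hT hj) hij

/-- a collar of width `r` is a collar of every smaller width (kernel ranges below the collar width). [cite: BalabanImbrieJaffe1988, Sect. 4 p.274] -/
theorem Collar.mono (h : Collar ρ r T S) (hr : r' ≤ r) : Collar ρ r' T S := fun i j hj hij => h i j hj (hij.trans hr)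

/-- the mirrored collar condition (points within `r` OF `T` lie in `S`) from `Collar`, for a symmetric distance. [cite: BalabanImbrieJaffe1988, Sect. 4 p.274] -/
theorem Collar.symm (hsym : ∀ i j, ρ i j = ρ j i) (h : Collar ρ r T S) : ∀ i j, i ∈ T → ρ i j ≤ r → j ∈ S :=
  fun i j hi hij => h j i hi (by rw [hsym]; exact hij)

/-- a collar inside a smaller region is a collar inside any larger one. [cite: BalabanImbrieJaffe1988, Sect. 4 p.274] -/
theorem Collar.of_subset {S' : Finset ι} (h : Collar ρ r T S) (hS : S ⊆ S') : Collar ρ r T S' := fun i j hj hij => hS (h i j hj hij)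

/-- the trivial collar: everything lies in the whole lattice. [cite: BalabanImbrieJaffe1988, Sect. 4 p.274] -/
theorem collar_univ [Fintype ι] (ρ : ι → ι → ℝ) (r : ℝ) (T : Finset ι) : Collar ρ r T Finset.univ := fun i _ _ _ => Finset.mem_univ i

end Collars

/-! ## §6  The support laws of the §5 files, in matrix form -/

section Laws

variable {ρ : ι → ι → ℝ} {r r₁ r₂ r₃ : ℝ} {S T : Finset ι} {K K₁ K₂ K₃ : Matrix ι ι ℝ}

/-- three-factor drop law — the shape of `hΛ1J` (`Λ₁**·Q^e_k∂^ηH_{k,loc}·Λ₂* = Q^e_k∂^ηH_{k,loc}·Λ₂*`), `hΛ45`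
(`Λ₄*·C_{loc}H*_{loc}X·Λ₅′** = C_{loc}H*_{loc}X·Λ₅′**`), `hΛ25`: composite kernel of range `≤ r₁ + r₂ + r₃` against a collar that wide.
[cite: BalabanImbrieJaffe1988, (5.5.6) p.284] -/
theorem chi_mul_mul₃_mul_chi_eq [Fintype ι] [DecidableEq ι] (htri : ∀ i j l, ρ i l ≤ ρ i j + ρ j l) (h₁ : HasRange ρ K₁ r₁) (h₂ : HasRange ρ K₂ r₂)
    (h₃ : HasRange ρ K₃ r₃) (hc : Collar ρ (r₁ + r₂ + r₃) T S) :
    chi S * (K₁ * K₂ * K₃) * chi T = K₁ * K₂ * K₃ * chi T :=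
  chi_mul_mul_chi_eq ((h₁.mul htri h₂).mul htri h₃) hc

/-- mirrored two-factor drop law followed by a further factor — the shape of `hΛ4σ` (`Λ₄*∂*σ_{k,loc}Λ₁**∂ = Λ₄*∂*σ_{k,loc}∂`).
[cite: BalabanImbrieJaffe1988, (5.5.6) p.284] -/
theorem chi_mul_mul_chi_mul_eq [Fintype ι] [DecidableEq ι] (htri : ∀ i j l, ρ i l ≤ ρ i j + ρ j l) (h₁ : HasRange ρ K₁ r₁) (h₂ : HasRange ρ K₂ r₂)
    (hc : ∀ i j, i ∈ T → ρ i j ≤ r₁ + r₂ → j ∈ S) (K₃ : Matrix ι ι ℝ) :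
    chi T * K₁ * K₂ * chi S * K₃ = chi T * K₁ * K₂ * K₃ := by
  have h := chi_mul_mul_chi_eq' (h₁.mul htri h₂) hc
  rw [← Matrix.mul_assoc] at h
  rw [h]

/-- the no-coupling law as the operator identity behind `hrange535`: `χ_{Λ₂**} σ_{k,loc} (1 − χ_{Λ₁**}) = 0` when `σ_{k,loc}` has range `≤ r`
((2.14)) and the `r`-neighbourhood of `Λ₂^{(k)**}` lies in `Λ₁^{(k)**}` (p. 274). [cite: BalabanImbrieJaffe1988, (5.3.5) p.280] -/
theorem rangeLaw535 [Fintype ι] [DecidableEq ι] (hσ : HasRange ρ K r) (hc : ∀ i j, i ∈ T → ρ i j ≤ r → j ∈ S) : chi T * K * (1 - chi S) = 0 :=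
  chi_mul_mul_one_sub_chi hσ hc

end Laws

/-! ## §7  Transfer to the operator carriers of the §5 files -/

/-- any representation of the matrix algebra (e.g. `Matrix.toLinAlgEquiv'`, or the action on an inner-product space of lattice fields)
carries a drop law to the corresponding identity of operators — the form in which `BIJ88CrossTerm556.Ops.Laws` states them.
[cite: BalabanImbrieJaffe1988, (5.5.6) p.284] -/
theorem map_dropLaw [Fintype ι] [DecidableEq ι] {R : Type*} [Semiring R] (φ : Matrix ι ι ℝ →+* R) {S T : Finset ι} {K : Matrix ι ι ℝ}
    (h : chi S * K * chi T = K * chi T) : φ (chi S) * φ K * φ (chi T) = φ K * φ (chi T) := by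
  simpa only [map_mul] using congrArg φ h

/-- transfer of the no-coupling law. [cite: BalabanImbrieJaffe1988, (5.3.5) p.280] -/
theorem map_zeroLaw [Fintype ι] [DecidableEq ι] {R : Type*} [Ring R] (φ : Matrix ι ι ℝ →+* R) {S T : Finset ι} {K : Matrix ι ι ℝ}
    (h : chi T * K * (1 - chi S) = 0) : φ (chi T) * φ K * (1 - φ (chi S)) = 0 := by
  simpa only [map_mul, map_sub, map_one, map_zero] using congrArg φ h

/-- the literal form of `BIJ88GaugeSummary5512.Ops.Laws.hrange535` / the mechanism of `BIJ88Quad535.qform_res_eq_zero_of_range`: in any real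
inner-product space, a symmetric `Λ` and the operator identity `Λσ(1 − Λ′) = 0` give `⟨Λx, σ(y − Λ′y)⟩ = 0` for all `x, y`.
[cite: BalabanImbrieJaffe1988, (5.3.5) p.280] -/
theorem inner_eq_zero_of_opLaw {M : Type*} [NormedAddCommGroup M] [InnerProductSpace ℝ M] {Λ σ Λ' : Module.End ℝ M}
    (hsym : ∀ x y : M, ⟪Λ x, y⟫ = ⟪x, Λ y⟫) (hop : Λ * σ * (1 - Λ') = 0) (x y : M) : ⟪Λ x, σ (y - Λ' y)⟫ = 0 := by
  have e : Λ (σ (y - Λ' y)) = 0 := by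
    simpa only [Module.End.mul_apply, LinearMap.sub_apply, Module.End.one_apply, LinearMap.zero_apply] using
      LinearMap.congr_fun hop y
  rw [hsym, e, inner_zero_right]


/-! ## §8  The Euclidean model: kernels acting on `ℓ²` lattice fields -/

section Model

variable [Fintype ι] [DecidableEq ι]

/-- kernels as operators on the Euclidean space of real lattice fields (Mathlib's `Matrix.toEuclideanCLM`, then forgetting continuity):
a ring homomorphism `Matrix ι ι ℝ →+* Module.End ℝ (EuclideanSpace ℝ ι)` — a carrier of the §5 files' dictionaries.
[cite: BalabanImbrieJaffe1988, (5.5.6) p.284] -/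
noncomputable def rep : Matrix ι ι ℝ →+* Module.End ℝ (EuclideanSpace ℝ ι) :=
  ContinuousLinearMap.toLinearMapRingHom.comp
    (Matrix.toEuclideanCLM (n := ι) (𝕜 := ℝ)).toRingEquiv.toRingHom

/-- `rep A` acts as `toEuclideanCLM A`. [cite: BalabanImbrieJaffe1988, (5.5.6) p.284] -/
theorem rep_apply (A : Matrix ι ι ℝ) (x : EuclideanSpace ℝ ι) : rep A x = Matrix.toEuclideanCLM (n := ι) (𝕜 := ℝ) A x := rfl

/-- matrix elements: `⟨x, (rep A) y⟩ = x ⬝ A y`. [cite: BalabanImbrieJaffe1988, (5.5.6) p.284] -/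
theorem inner_rep (A : Matrix ι ι ℝ) (x y : EuclideanSpace ℝ ι) : ⟪x, rep A y⟫ = x.ofLp ⬝ᵥ A.mulVec y.ofLp := by
  rw [rep_apply, Matrix.inner_toEuclideanCLM]

/-- symmetric kernels (characteristic functions, `σ_{k,loc}`, `C^{(k)}_{loc}`, …) act as symmetric operators.
[cite: BalabanImbrieJaffe1988, (5.5.6) p.284] -/
theorem rep_symm {A : Matrix ι ι ℝ} (hA : A.transpose = A) (x y : EuclideanSpace ℝ ι) : ⟪rep A x, y⟫ = ⟪x, rep A y⟫ := by
  rw [real_inner_comm, inner_rep, inner_rep, Matrix.dotProduct_mulVec, ← Matrix.mulVec_transpose, hA, dotProduct_comm]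

/-- the drop law in the model (the shape of `BIJ88CrossTerm556.Ops.Laws.hΛ14` & co. as operator identities).
[cite: BalabanImbrieJaffe1988, (5.5.6) p.284] -/
theorem rep_dropLaw {ρ : ι → ι → ℝ} {K : Matrix ι ι ℝ} {r : ℝ} {S T : Finset ι} (hK : HasRange ρ K r) (hc : Collar ρ r T S) :
    rep (chi S) * rep K * rep (chi T) = rep K * rep (chi T) :=
  map_dropLaw rep (chi_mul_mul_chi_eq hK hc)

/-- the range statement of (5.3.5) in the model, in the literal form of `BIJ88GaugeSummary5512.Ops.Laws.hrange535`:
`⟨χ_T x, K(y − χ_S y)⟩ = 0` when `K` has range `≤ r` and every point within `r` of `T` lies in `S`. [cite: BalabanImbrieJaffe1988, (5.3.5) p.280] -/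
theorem rep_inner_law {ρ : ι → ι → ℝ} {K : Matrix ι ι ℝ} {r : ℝ} {S T : Finset ι} (hK : HasRange ρ K r)
    (hc : ∀ i j, i ∈ T → ρ i j ≤ r → j ∈ S) (x y : EuclideanSpace ℝ ι) :
    ⟪rep (chi T) x, rep K (y - rep (chi S) y)⟫ = 0 :=
  inner_eq_zero_of_opLaw (rep_symm (chi_transpose T)) (map_zeroLaw rep (rangeLaw535 hK hc)) x y

end Model

end Literature.MathematicalPhysics.QuantumFieldTheory.BalabanImbrieJaffe1984to88.BIJ88SupportLaws274
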